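import Summits.Parity.GeneralizedHardyLittlewood.Theses.GoldbachHeathBrownDispersion
import Literature.NumberTheory.Sieve.CubicBoxModelMainTerm
import HarnessLib

/-!
# Route `GoldbachHeathBrownDispersion` — crux `ModelMainTerm` (stmt-Parity-19918)

The crux `ModelMainTerm` (main term of the sieve model `ũ` against the rough model `g`, with an
ABSOLUTE constant `c₀` chosen before the box exponent `c` and the rough level `B`) is, verbatim, the
Literature kernel theorem `Literature.NumberTheory.Sieve.CubicMinorant.boxModel_mainTerm_lower`
(file `Literature/NumberTheory/Sieve/CubicBoxModelMainTerm.lean`, cell parity-ideate lit g14,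
p511331): a two-dimensional fundamental lemma on the box pairs with the local factors of
`x³ + 2y³` bounded below uniformly in the even target `n`.  This file closes the item by name.

References: H. Halberstam, H.-E. Richert, *Sieve Methods* (1974), Thm 2.5 with Thm 2.2
[HalberstamRichert1974]; D. R. Heath-Brown, Acta Math. 186 (2001) [HeathBrownActa2001].
-/

namespace Summit.Parity.GeneralizedHardyLittlewood.Theorems

/-- **`ModelMainTerm` holds** (route `GoldbachHeathBrownDispersion`, crux stmt-Parity-19918): there is an
absolute `c₀ > 0` such that for all `c, B > 0`, `N ≥ N₀(c, B)` and every even `n ∈ (N, 2N]`,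
`c₀ · U ≤ ∑_{k ≤ N} ũ(k) · roughModel B (2N) (n − k)`, where `U` is the mass of the Heath-Brown weight
`hbWeight c N` and `ũ` the box sieve model of the same mass.  Proof: the Literature theorem
`CubicMinorant.boxModel_mainTerm_lower` is this statement. -/
theorem goldbachHeathBrownDispersion_modelMainTerm_proof :
    Summit.Parity.GeneralizedHardyLittlewood.Theses.GoldbachHeathBrownDispersion.ModelMainTerm := by
  unfold Summit.Parity.GeneralizedHardyLittlewood.Theses.GoldbachHeathBrownDispersion.ModelMainTerm
  exact Literature.NumberTheory.Sieve.CubicMinorant.boxModel_mainTerm_lower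

end Summit.Parity.GeneralizedHardyLittlewood.Theorems
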